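import Mathlib
import Summits.Ventures.PercRepro.TriangleCapThirdOrderTen

/-!
# PercRepro — THE PIECES OF THE THIRD-ORDER LOCUS ON `(10, 21)` (p3, gen 46; part 199j, first half)

For part 199j (the graphs on `(10, 21)` that are neither `3`- nor `4`-bipartite at `Σ_v d(v)² = 190` are `K_{5,5}` minus
a `4`-star): a sum of values `≤ c` equal to `c |N|` is constant (`eq_of_sum_eq_card_mul`); a vertex off the side `A`
of a spanning subgraph of `K(A, Aᶜ)` with degree `|A|` sees all of `A` (`adj_all_of_deg_eq_card`); the degree
sequence forbids three vertices of degree `6` around a vertex of degree `3` at `190` (`(d − 3)(d − 4) ≥ 0` on the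
other six vertices: `7 · 21 ≤ 73 + 72` fails, `no_three_six_three`); in the hung `K_{4,4}` two distinct vertices of
degree `5` are the ends of the hung edge — adjacent, with the hung vertex as a common neighbour
(`hungK44_deg_five_adj`). Axioms: standard.
-/

namespace PercRepro

namespace TriangleCap

namespace C047

open Finset

variable {V : Type*} [Fintype V] [DecidableEq V]

/-- A sum of values `≤ c` over `N` equal to `c |N|` has every value equal to `c`. -/
theorem eq_of_sum_eq_card_mul {W : Type*} (N : Finset W) (f : W → ℕ) (c : ℕ) (hf : ∀ w ∈ N, f w ≤ c)
    (hsum : ∑ w ∈ N, f w = N.card * c) : ∀ w ∈ N, f w = c := by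
  have h : ∑ w ∈ N, f w = ∑ _w ∈ N, c := by rw [hsum, sum_const, smul_eq_mul]
  exact (sum_eq_sum_iff_of_le hf).mp h

/-- In a spanning subgraph of `K(A, Aᶜ)`, a vertex off `A` of degree `|A|` is adjacent to all of `A`. -/
theorem adj_all_of_deg_eq_card (H : SimpleGraph V) [DecidableRel H.Adj] (A : Finset V) (hH : BipSub H A)
    (b : V) (hb : b ∉ A) (hd : deg H b = A.card) : ∀ a ∈ A, H.Adj b a := by
  intro a ha
  have hsub : univ.filter (fun w => H.Adj b w) ⊆ A := by
    intro w hw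
    rw [mem_filter] at hw
    have := hH b w hw.2
    tauto
  have heq : univ.filter (fun w => H.Adj b w) = A := eq_of_subset_of_card_le hsub (by rw [← hd]; rfl)
  have : a ∈ univ.filter (fun w => H.Adj b w) := by rw [heq]; exact ha
  exact (mem_filter.mp this).2

/-- `7d ≤ d² + 12` for every natural `d` (`(d − 3)(d − 4) ≥ 0`). -/
theorem seven_mul_le_sq_add_twelve (d : ℕ) : 7 * d ≤ d * d + 12 := by
  rcases Nat.lt_or_ge d 4 with h | h
  · interval_cases d <;> norm_num
  · nlinarith

/-- **THE DEGREE SEQUENCE FORBIDS THREE VERTICES OF DEGREE `6` AROUND A VERTEX OF DEGREE `3` AT `190`:** on `10`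
vertices with `21` edges and `Σ_v d(v)² = 190`, the other six vertices would have degree sum `21` and square sum
`73`, against `7 · 21 ≤ 73 + 72`. -/
theorem no_three_six_three (D : SimpleGraph V) [DecidableRel D.Adj] (hk : Fintype.card V = 10)
    (hm : D.edgeFinset.card = 21) (heq : ∑ v, deg D v * deg D v = 190) (z : V) (hz : deg D z = 3)
    (h6 : ∀ w, D.Adj z w → deg D w = 6) : False := by
  obtain ⟨N, hN⟩ : ∃ N : Finset V, N = univ.filter (fun w => D.Adj z w) := ⟨_, rfl⟩
  have hmemN : ∀ w, w ∈ N ↔ D.Adj z w := fun w => by rw [hN, mem_filter]; simp only [mem_univ, true_and]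
  have hzN : z ∉ N := fun h => D.irrefl ((hmemN z).mp h)
  have hNcard : N.card = 3 := by rw [hN]; exact hz
  obtain ⟨S, hS⟩ : ∃ S : Finset V, S = insert z N := ⟨_, rfl⟩
  have hScard : S.card = 4 := by rw [hS, card_insert_of_notMem hzN, hNcard]
  have hdegsum := sum_deg_eq D
  rw [hm] at hdegsum
  have hsplit : ∀ F : V → ℕ, ∑ v, F v = ∑ v ∈ S, F v + ∑ v ∈ Sᶜ, F v := fun F =>
    (sum_add_sum_compl S F).symm
  have hSdeg : ∑ v ∈ S, deg D v = 21 := by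
    rw [hS, sum_insert hzN, hz]
    have : ∑ v ∈ N, deg D v = ∑ _v ∈ N, 6 := sum_congr rfl (fun w hw => h6 w ((hmemN w).mp hw))
    rw [this, sum_const, smul_eq_mul, hNcard]
  have hSsq : ∑ v ∈ S, deg D v * deg D v = 117 := by
    rw [hS, sum_insert hzN, hz]
    have : ∑ v ∈ N, deg D v * deg D v = ∑ _v ∈ N, 36 := sum_congr rfl (fun w hw => by rw [h6 w ((hmemN w).mp hw)])
    rw [this, sum_const, smul_eq_mul, hNcard]
  have hcompl : Sᶜ.card = 6 := by rw [card_compl, hScard, hk]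
  have hC : ∑ v ∈ Sᶜ, 7 * deg D v ≤ ∑ v ∈ Sᶜ, (deg D v * deg D v + 12) :=
    sum_le_sum (fun v _ => seven_mul_le_sq_add_twelve (deg D v))
  rw [← mul_sum, sum_add_distrib, sum_const, smul_eq_mul, hcompl] at hC
  rw [hsplit, hSdeg] at hdegsum
  rw [hsplit, hSsq] at heq
  omega

/-- In the hung `K_{4,4}` two distinct vertices of degree `5` are adjacent and have a common neighbour. -/
theorem hungK44_deg_five_adj (D : SimpleGraph V) [DecidableRel D.Adj] (hk : Fintype.card V = 9) (hH : HungK44 D)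
    (t₁ t₂ : V) (h12 : t₁ ≠ t₂) (hd1 : deg D t₁ = 5) (hd2 : deg D t₂ = 5) :
    D.Adj t₁ t₂ ∧ ∃ w, D.Adj t₁ w ∧ D.Adj t₂ w := by
  obtain ⟨w, A, hw2, hA4, hB, hE16, x, y, hxA, hyA, hxw, hyw⟩ := hH
  have hcard' := card_del w
  -- a vertex of degree `5` is adjacent to `w` and has degree `4` in `D − w`
  have hfive : ∀ t : {v : V // v ≠ w}, deg D t.1 = 5 → D.Adj t.1 w ∧ deg (del D w) t = 4 := by
    intro t ht
    have h := deg_del D w t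
    have hle : deg (del D w) t ≤ 4 := by
      by_cases htA : t ∈ A
      · have := deg_le_of_bipSub_mem (del D w) A hB t htA
        rw [hA4] at this
        omega
      · have := deg_le_card_of_bipSub (del D w) A hB t htA
        rw [hA4] at this
        exact this
    by_cases htw : D.Adj t.1 w
    · rw [if_pos htw] at h
      exact ⟨htw, by omega⟩
    · rw [if_neg htw] at h
      omega
  -- the neighbours of `w` are exactly `x` and `y`
  have hnb : ∀ t : {v : V // v ≠ w}, D.Adj t.1 w → t = x ∨ t = y := by
    intro t ht
    by_contra hcon
    push Not at hcon
    have h3 : 3 ≤ (univ.filter (fun a : {v : V // v ≠ w} => D.Adj a.1 w)).card := by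
      have hsub : ({t, x, y} : Finset {v : V // v ≠ w}) ⊆ univ.filter (fun a => D.Adj a.1 w) := by
        intro s hs
        rw [mem_filter]
        simp only [mem_insert, mem_singleton] at hs
        rcases hs with rfl | rfl | rfl
        · exact ⟨mem_univ _, ht⟩
        · exact ⟨mem_univ _, hxw⟩
        · exact ⟨mem_univ _, hyw⟩
      have hxy : x ≠ y := fun h => hyA (h ▸ hxA)
      have hc : ({t, x, y} : Finset {v : V // v ≠ w}).card = 3 := by
        rw [card_insert_of_notMem, card_insert_of_notMem, card_singleton]
        · rw [mem_singleton]; exact hxy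
        · rw [mem_insert, mem_singleton]; push Not; exact hcon
      have := card_le_card hsub
      omega
    rw [card_nbhd_del, hw2] at h3
    omega
  have ht₁w : t₁ ≠ w := fun h => by rw [h, hw2] at hd1; omega
  have ht₂w : t₂ ≠ w := fun h => by rw [h, hw2] at hd2; omega
  obtain ⟨h1w, -⟩ := hfive ⟨t₁, ht₁w⟩ hd1
  obtain ⟨h2w, -⟩ := hfive ⟨t₂, ht₂w⟩ hd2
  have hfull : ∀ {p q : {v : V // v ≠ w}}, p ∈ A → q ∉ A → (del D w).Adj p q := fun hp hq =>
    adj_of_bipSub_full (del D w) A hB 4 hA4 (by rw [hE16]; omega) hp hq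
  have hxy : (del D w).Adj x y := hfull hxA hyA
  refine ⟨?_, w, h1w, h2w⟩
  rcases hnb ⟨t₁, ht₁w⟩ h1w with e1 | e1 <;> rcases hnb ⟨t₂, ht₂w⟩ h2w with e2 | e2
  · exact absurd (congrArg Subtype.val (e1.trans e2.symm)) h12
  · have := (del_adj D w x y).mp hxy
    rw [← e1, ← e2] at this
    exact this
  · have := (del_adj D w x y).mp hxy
    rw [← e1, ← e2] at this
    exact D.adj_symm this
  · exact absurd (congrArg Subtype.val (e1.trans e2.symm)) h12

end C047

end TriangleCap

end PercRepro
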